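import Summits.QuantumFields.GaugeBoot.SOMasterLoopIdentity
import Literature.MathematicalPhysics.QuantumFieldTheory.Chatterjee2019LargeN.UnitLoops
import HarnessLib

/-!
# The summed contractions as Chatterjee's four terms, pointwise in the configuration (gauge-boot, ADDENDUM 27 part M5c)

HONEST FRAMING (cell `pub-gaugeboot`, page 1 of every file): the venture produces certified bounds
on lattice expectations at stated coupling, gauge group, dimension and torus size; NOT a mass gap,
NOT a continuum limit, NOT a string tension; NOT Yang–Mills-summit-bearing (barriers
`FixedCouplingUltralocality`, `PerturbativeInvisibility`).  Pointwise identities; nothing about a measure is claimed.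

## Content

Tenth file of the lane's programme on the tree's NAMED FACT `Chatterjee2019LargeN.UnsymmetrizedMasterLoopEquation`
(Chatterjee, CMP 366 (2019), Theorem 8.1).  With the marked letter `e = l[x₀]`, its undirected link `ε = e.1`, the
index sets `locs`, `samePairs`, `invPairs` of `MasterLoopEquation` and `W_w = tr holC(w)`, the sums over ALL
locations and all `(i, j)` of the integrands of part M5b are, configuration by configuration:

* ★ `sum_ins2_eq` — `Σ_x Σ_y Σ_ij tr(ins2Prod_{x,y}) = −2(N−1)·m·W_l + 2·(twisting sum) + 2·(splitting sum)`,
  `m = occ l e` (Casimir at the diagonal, parts M4c/O1–O3 off it; letters off `ε` vanish);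
* ★ `sum_merge_eq` — `Σ_x Σ_ij tr(insProd_x)·(Π W)'_ij = 2·Σ_r Σ_{x ∈ C₁} Σ_{y ∈ C_r} (Π_{r' ≠ r} W)(W(l ⊖ l_r) − W(l ⊕ l_r))`;
* ★ `sum_deform_eq` — `Σ_x Σ_ij tr(insProd_x)·S'_ij = −2·Σ_{p ∈ 𝒫⁺(e)} Σ_{x ∈ C₁} (W(l ⊖ₓ p) − W(l ⊕ₓ p))` (the unique
  location of `ε` in `∂p` is `plaquetteLoc`, tree `plaquetteLoc_plaquetteWord`).

Everything is `[folklore]`.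
-/

noncomputable section

open NormedSpace MeasureTheory
open scoped Matrix.Norms.Frobenius Matrix
open Literature.Probability.LatticeModels (Site)
open Literature.MathematicalPhysics.QuantumLattice (LGConfig ZdEdge ZdPlaquette plaquettesTouching plaquetteEdges
  mem_plaquettesTouching_iff)
open Literature.MathematicalPhysics.QuantumFieldTheory (Chatterjee2019LargeN.Word)
open Literature.MathematicalPhysics.QuantumFieldTheory.Chatterjee2019LargeN
  (SO soRep DEdge LoopSeq plaquetteWord plaquettesAt plaquetteWord_map_fst_nodup)
open Literature.MathematicalPhysics.QuantumFieldTheory.Chatterjee2019LargeN.Word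
  (locs occ samePairs invPairs letter plaquetteLoc posSplit₁ posSplit₂ negSplit₁ negSplit₂ negTwist posTwist posMerge
   negMerge posDeform negDeform ne_of_get_eq_inv exists_letter_of_mem_plaquetteEdges)
open Literature.MathematicalPhysics.QuantumFieldTheory.Chatterjee2019LargeN.PlaquetteFirstOrderProof
  (plaquetteLoc_plaquetteWord)

namespace Summit.QuantumFields.GaugeBoot

namespace SOMasterLoop

variable {d N : ℕ}

/-! ## Letters on the marked link: the index sets of Theorem 8.1 -/

section IndexSets

variable (l : Chatterjee2019LargeN.Word d) (e : DEdge d)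

/-- `a` carries the undirected edge of `e` iff `a ∈ {e, e⁻¹}`. [folklore] -/
theorem fst_eq_iff_eq_or_eq_inv (a : DEdge d) : a.1 = e.1 ↔ a = e ∨ a = DEdge.inv e := by
  constructor
  · intro h
    rcases a with ⟨a1, a2⟩
    rcases e with ⟨e1, e2⟩
    simp only at h
    subst h
    cases a2 <;> cases e2 <;> simp [DEdge.inv]
  · rintro (rfl | rfl)
    · rfl
    · rfl

/-- `x ∈ C₁ = locs l e` iff the letter at `x` lies on the link of `e`. [folklore] -/
theorem mem_locs_iff (x : Fin l.length) : x ∈ locs l e ↔ (l.get x).1 = e.1 := by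
  rw [locs, Finset.mem_filter, fst_eq_iff_eq_or_eq_inv]
  simp

/-- Membership in `samePairs`. [folklore] -/
theorem mem_samePairs_iff (xy : Fin l.length × Fin l.length) :
    xy ∈ samePairs l e ↔ xy.1 ≠ xy.2 ∧ l.get xy.2 = l.get xy.1 ∧ (l.get xy.1).1 = e.1 := by
  rw [samePairs, Finset.mem_filter, fst_eq_iff_eq_or_eq_inv]
  simp only [Finset.mem_univ, true_and]
  constructor
  · rintro ⟨h1, h2, h3⟩; exact ⟨h1, h2.symm, h3⟩
  · rintro ⟨h1, h2, h3⟩; exact ⟨h1, h2.symm, h3⟩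

/-- Membership in `invPairs`. [folklore] -/
theorem mem_invPairs_iff (xy : Fin l.length × Fin l.length) :
    xy ∈ invPairs l e ↔ (l.get xy.1).1 = e.1 ∧ l.get xy.2 = DEdge.inv (l.get xy.1) := by
  rw [invPairs, Finset.mem_filter]
  simp only [Finset.mem_univ, true_and]
  constructor
  · rintro (⟨h1, h2⟩ | ⟨h1, h2⟩)
    · exact ⟨by rw [h1], by rw [h2, h1]⟩
    · refine ⟨by rw [h1]; rfl, by rw [h2, h1, DEdge.inv_inv]⟩
  · rintro ⟨h1, h2⟩
    rcases (fst_eq_iff_eq_or_eq_inv e _).1 h1 with h | h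
    · exact Or.inl ⟨h, by rw [h2, h]⟩
    · exact Or.inr ⟨h, by rw [h2, h, DEdge.inv_inv]⟩

end IndexSets

/-! ## The double-insertion sum: Casimir, twistings, splittings -/

section Ins2

variable (U : LGConfig d (SO N)) (l : Chatterjee2019LargeN.Word d) (e : DEdge d)

/-- The `(i,j)`-summed double insertion at a pair of locations. [folklore] -/
def pairSum (xy : Fin l.length × Fin l.length) : ℂ :=
  ∑ i : Fin N, ∑ j : Fin N, (ins2Prod e.1 (soDir i j) l xy.1 xy.2 U).trace

/-- The diagonal index set `{(x, x) : x ∈ C₁}`. [folklore] -/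
def diagPairs : Finset (Fin l.length × Fin l.length) := (locs l e).image fun x => (x, x)

/-- `pairSum` vanishes off `diagPairs ∪ samePairs ∪ invPairs`. [folklore] -/
theorem pairSum_eq_zero_of_not_mem {xy : Fin l.length × Fin l.length}
    (h : xy ∉ diagPairs l e ∪ samePairs l e ∪ invPairs l e) : pairSum U l e xy = 0 := by
  unfold pairSum
  by_cases h1 : (l.get xy.1).1 = e.1
  · by_cases hd : xy.2 = xy.1
    · exfalso; apply h
      rw [Finset.mem_union, Finset.mem_union, diagPairs, Finset.mem_image]
      exact Or.inl (Or.inl ⟨xy.1, (mem_locs_iff l e _).2 h1, Prod.ext rfl hd.symm⟩)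
    · by_cases h2 : (l.get xy.2).1 = e.1
      · exfalso; apply h
        rw [Finset.mem_union, Finset.mem_union, mem_samePairs_iff, mem_invPairs_iff]
        rcases (fst_eq_iff_eq_or_eq_inv (l.get xy.1) (l.get xy.2)).1 (h2.trans h1.symm) with h3 | h3
        · exact Or.inl (Or.inr ⟨Ne.symm hd, h3, h1⟩)
        · exact Or.inr ⟨h1, h3⟩
      · simp [ins2Prod_eq_zero_right e.1 U l _ h2]
  · simp [ins2Prod_eq_zero_left e.1 U l _ h1]

/-- The three index sets are pairwise disjoint. [folklore] -/
theorem disjoint_index_sets :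
    Disjoint (diagPairs l e) (samePairs l e) ∧ Disjoint (diagPairs l e ∪ samePairs l e) (invPairs l e) := by
  constructor
  · rw [Finset.disjoint_left]
    intro xy hd hs
    rw [diagPairs, Finset.mem_image] at hd
    obtain ⟨x, -, rfl⟩ := hd
    exact ((mem_samePairs_iff l e _).1 hs).1 rfl
  · rw [Finset.disjoint_left]
    intro xy hds hi
    have hi' := (mem_invPairs_iff l e _).1 hi
    rw [Finset.mem_union] at hds
    rcases hds with hd | hs
    · rw [diagPairs, Finset.mem_image] at hd
      obtain ⟨x, -, rfl⟩ := hd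
      exact DEdge.inv_ne_self _ hi'.2.symm
    · have hs' := (mem_samePairs_iff l e _).1 hs
      exact DEdge.inv_ne_self _ (hi'.2.symm.trans hs'.2.1)

/-- ★ **The double-insertion sum as Casimir + twistings + splittings**:
`Σ_x Σ_y Σ_ij tr(ins2Prod_{x,y}) = −2(N−1)·m·W_l + 2 Σ_{same} (W(∝⁻) − W(×¹⁺)W(×²⁺)) + 2 Σ_{inv} (W(×¹⁻)W(×²⁻) − W(∝⁺))`.
[folklore] -/
theorem sum_ins2_eq :
    ∑ x : Fin l.length, ∑ y : Fin l.length, pairSum U l e (x, y) =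
      -(2 * ((N : ℂ) - 1)) * (occ l e : ℂ) * (holC U l).trace +
      2 * (∑ xy ∈ samePairs l e, ((holC U (negTwist l xy.1 xy.2)).trace -
              (holC U (posSplit₁ l xy.1 xy.2)).trace * (holC U (posSplit₂ l xy.1 xy.2)).trace) +
           ∑ xy ∈ invPairs l e, ((holC U (negSplit₁ l xy.1 xy.2)).trace * (holC U (negSplit₂ l xy.1 xy.2)).trace -
              (holC U (posTwist l xy.1 xy.2)).trace)) := by
  rw [← Finset.sum_product', Finset.univ_product_univ,
    ← Finset.sum_subset (Finset.subset_univ (diagPairs l e ∪ samePairs l e ∪ invPairs l e))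
      (fun xy _ hxy => pairSum_eq_zero_of_not_mem U l e hxy),
    Finset.sum_union (disjoint_index_sets l e).2, Finset.sum_union (disjoint_index_sets l e).1]
  -- diagonal
  have hD : ∑ xy ∈ diagPairs l e, pairSum U l e xy = -(2 * ((N : ℂ) - 1)) * (occ l e : ℂ) * (holC U l).trace := by
    rw [diagPairs, Finset.sum_image (fun x _ y _ h => (Prod.ext_iff.1 h).1)]
    have hc : ∀ x ∈ locs l e, pairSum U l e (x, x) = -(2 * ((N : ℂ) - 1)) * (holC U l).trace :=
      fun x hx => sum_trace_ins2Prod_self e.1 U l ((mem_locs_iff l e x).1 hx)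
    rw [Finset.sum_congr rfl hc, Finset.sum_const, occ, nsmul_eq_mul]
    ring
  -- same pairs
  have hS : ∑ xy ∈ samePairs l e, pairSum U l e xy = 2 * ∑ xy ∈ samePairs l e,
      ((holC U (negTwist l xy.1 xy.2)).trace -
        (holC U (posSplit₁ l xy.1 xy.2)).trace * (holC U (posSplit₂ l xy.1 xy.2)).trace) := by
    rw [Finset.mul_sum]
    refine Finset.sum_congr rfl fun xy hxy => ?_
    obtain ⟨h1, h2, h3⟩ := (mem_samePairs_iff l e xy).1 hxy
    exact sum_trace_ins2Prod_same e.1 U l h1 h2 h3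
  -- inverse pairs
  have hI : ∑ xy ∈ invPairs l e, pairSum U l e xy = 2 * ∑ xy ∈ invPairs l e,
      ((holC U (negSplit₁ l xy.1 xy.2)).trace * (holC U (negSplit₂ l xy.1 xy.2)).trace -
        (holC U (posTwist l xy.1 xy.2)).trace) := by
    rw [Finset.mul_sum]
    refine Finset.sum_congr rfl fun xy hxy => ?_
    obtain ⟨h1, h2⟩ := (mem_invPairs_iff l e xy).1 hxy
    exact sum_trace_ins2Prod_inv e.1 U l h2 h1
  rw [hD, hS, hI]
  ring

end Ins2

/-! ## The merger sum -/

section Merge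

variable (U : LGConfig d (SO N)) (l : Chatterjee2019LargeN.Word d) (e : DEdge d) (rest : LoopSeq d)

/-- The two-word contraction vanishes unless both locations are on the link. [folklore] -/
theorem sum_trace_insProd_mul_eq (m : Chatterjee2019LargeN.Word d) (x : Fin l.length) (y : Fin m.length) :
    ∑ i : Fin N, ∑ j : Fin N, (insProd e.1 (soDir i j) l x U).trace * (insProd e.1 (soDir i j) m y U).trace =
      if (l.get x).1 = e.1 ∧ (m.get y).1 = e.1 then
        2 * ((holC U (negMerge l x m y)).trace - (holC U (posMerge l x m y)).trace) else 0 := by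
  split_ifs with h
  · exact sum_trace_insProd_mul_trace_insProd e.1 U l m h.1 h.2
  · rw [not_and_or] at h
    rcases h with h | h
    · simp [insProd_eq_zero_of_ne e.1 U l _ h]
    · simp [insProd_eq_zero_of_ne e.1 U m _ h]

/-- ★ **The merger sum**:
`Σ_x Σ_ij tr(insProd_x)·(Π W)'_ij = 2 Σ_r (Π_{r' ≠ r} W_{l_{r'}}) Σ_{x ∈ C₁} Σ_{y ∈ C_r} (W(l ⊖_{x,y} l_r) − W(l ⊕_{x,y} l_r))`.
[folklore] -/
theorem sum_merge_eq :
    ∑ x : Fin l.length, ∑ i : Fin N, ∑ j : Fin N, (insProd e.1 (soDir i j) l x U).trace * prodW' e.1 (soDir i j) rest U =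
      2 * ∑ r : Fin rest.length, (∏ r' ∈ Finset.univ.erase r, (holC U (rest.get r')).trace) *
        ∑ x ∈ locs l e, ∑ y ∈ locs (rest.get r) e,
          ((holC U (negMerge l x (rest.get r) y)).trace - (holC U (posMerge l x (rest.get r) y)).trace) := by
  -- expand `prodW'` and move the `(i,j)` sums inside
  have h1 : ∀ x : Fin l.length, ∑ i : Fin N, ∑ j : Fin N,
      (insProd e.1 (soDir i j) l x U).trace * prodW' e.1 (soDir i j) rest U =
      ∑ r : Fin rest.length, (∏ r' ∈ Finset.univ.erase r, (holC U (rest.get r')).trace) *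
        ∑ y : Fin (rest.get r).length, ∑ i : Fin N, ∑ j : Fin N,
          (insProd e.1 (soDir i j) l x U).trace * (insProd e.1 (soDir i j) (rest.get r) y U).trace := by
    intro x
    set P : Fin rest.length → ℂ := fun r => ∏ r' ∈ Finset.univ.erase r, (holC U (rest.get r')).trace with hP
    set A : Fin N → Fin N → ℂ := fun i j => (insProd e.1 (soDir i j) l x U).trace with hA
    set B : (r : Fin rest.length) → Fin (rest.get r).length → Fin N → Fin N → ℂ :=
      fun r y i j => (insProd e.1 (soDir i j) (rest.get r) y U).trace with hB
    calc ∑ i : Fin N, ∑ j : Fin N, A i j * prodW' e.1 (soDir i j) rest U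
        = ∑ i : Fin N, ∑ j : Fin N, ∑ r : Fin rest.length, ∑ y : Fin (rest.get r).length, P r * (A i j * B r y i j) := by
          refine Finset.sum_congr rfl fun i _ => Finset.sum_congr rfl fun j _ => ?_
          rw [prodW', Finset.mul_sum]
          refine Finset.sum_congr rfl fun r _ => ?_
          rw [Finset.mul_sum, Finset.mul_sum]
          refine Finset.sum_congr rfl fun y _ => ?_
          simp only [hP, hA, hB]
          ring
      _ = ∑ i : Fin N, ∑ r : Fin rest.length, ∑ j : Fin N, ∑ y : Fin (rest.get r).length, P r * (A i j * B r y i j) :=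
          Finset.sum_congr rfl fun i _ => Finset.sum_comm
      _ = ∑ r : Fin rest.length, ∑ i : Fin N, ∑ j : Fin N, ∑ y : Fin (rest.get r).length, P r * (A i j * B r y i j) :=
          Finset.sum_comm
      _ = ∑ r : Fin rest.length, ∑ i : Fin N, ∑ y : Fin (rest.get r).length, ∑ j : Fin N, P r * (A i j * B r y i j) :=
          Finset.sum_congr rfl fun r _ => Finset.sum_congr rfl fun i _ => Finset.sum_comm
      _ = ∑ r : Fin rest.length, ∑ y : Fin (rest.get r).length, ∑ i : Fin N, ∑ j : Fin N, P r * (A i j * B r y i j) :=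
          Finset.sum_congr rfl fun r _ => Finset.sum_comm
      _ = ∑ r : Fin rest.length, P r * ∑ y : Fin (rest.get r).length, ∑ i : Fin N, ∑ j : Fin N, A i j * B r y i j := by
          simp only [Finset.mul_sum]
  simp only [h1, sum_trace_insProd_mul_eq]
  rw [Finset.sum_comm, Finset.mul_sum]
  refine Finset.sum_congr rfl fun r _ => ?_
  rw [← Finset.mul_sum, ← mul_assoc, mul_comm (2 : ℂ), mul_assoc]
  congr 1
  rw [Finset.mul_sum]
  -- restrict `x` to `C₁` and `y` to `C_r`
  rw [← Finset.sum_subset (Finset.subset_univ (locs l e)) (fun x _ hx => ?_)]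
  · refine Finset.sum_congr rfl fun x hx => ?_
    rw [Finset.mul_sum, ← Finset.sum_subset (Finset.subset_univ (locs (rest.get r) e)) (fun y _ hy => ?_)]
    · refine Finset.sum_congr rfl fun y hy => ?_
      rw [if_pos ⟨(mem_locs_iff l e x).1 hx, (mem_locs_iff _ e y).1 hy⟩]
    · rw [if_neg (fun h => hy ((mem_locs_iff _ e y).2 h.2))]
  · refine Finset.sum_eq_zero fun y _ => ?_
    rw [if_neg (fun h => hx ((mem_locs_iff l e x).2 h.1))]

end Merge

/-! ## The deformation sum -/

section Deform

variable (U : LGConfig d (SO N)) (l : Chatterjee2019LargeN.Word d) (e : DEdge d)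

/-- For `p ∈ 𝒫⁺(e)`, the undirected edge of `e` occurs in `∂p` exactly at `plaquetteLoc`. [folklore] -/
theorem exists_loc_plaquetteWord {p : ZdPlaquette d} (hp : p ∈ plaquettesAt e) :
    ∃ z₀ : Fin (plaquetteWord p).length, ((plaquetteWord p).get z₀).1 = e.1 ∧ plaquetteLoc p e.1 = z₀ ∧
      ∀ z : Fin (plaquetteWord p).length, ((plaquetteWord p).get z).1 = e.1 → z = z₀ := by
  have hmem : e.1 ∈ plaquetteEdges p := by
    rw [plaquettesAt, mem_plaquettesTouching_iff] at hp
    obtain ⟨f, hf⟩ := hp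
    rw [Finset.mem_inter, Finset.mem_singleton] at hf
    exact hf.2 ▸ hf.1
  obtain ⟨a, ha, hae⟩ := exists_letter_of_mem_plaquetteEdges hmem
  obtain ⟨z₀, hz₀⟩ := List.mem_iff_get.1 ha
  refine ⟨z₀, by rw [hz₀, hae], ?_, fun z hz => ?_⟩
  · have := plaquetteLoc_plaquetteWord p z₀
    rw [hz₀, hae] at this
    exact this
  · have hnd := plaquetteWord_map_fst_nodup p
    have hz' : ((plaquetteWord p).map Prod.fst).get ⟨z, by rw [List.length_map]; exact z.isLt⟩ =
        ((plaquetteWord p).map Prod.fst).get ⟨z₀, by rw [List.length_map]; exact z₀.isLt⟩ := by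
      simp only [List.get_eq_getElem, List.getElem_map]
      rw [← List.get_eq_getElem, ← List.get_eq_getElem, hz, hz₀, hae]
    have := (List.Nodup.get_inj_iff hnd).1 hz'
    exact Fin.ext (congrArg Fin.val this)

/-- The deformation contraction of one plaquette: only the location `plaquetteLoc` contributes. [folklore] -/
theorem sum_deform_plaquette {p : ZdPlaquette d} (hp : p ∈ plaquettesAt e) {x : Fin l.length} (hx : (l.get x).1 = e.1) :
    ∑ z : Fin (plaquetteWord p).length, ∑ i : Fin N, ∑ j : Fin N,
        (insProd e.1 (soDir i j) l x U).trace * (insProd e.1 (soDir i j) (plaquetteWord p) z U).trace =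
      2 * ((holC U (negDeform l x p)).trace - (holC U (posDeform l x p)).trace) := by
  obtain ⟨z₀, hz₀, hloc, huniq⟩ := exists_loc_plaquetteWord e hp
  rw [Finset.sum_eq_single z₀]
  · rw [sum_trace_insProd_mul_trace_insProd e.1 U l (plaquetteWord p) hx hz₀, negMerge, posMerge, negDeform, posDeform,
      letter, hx, hloc]
  · intro z _ hz
    simp only [sum_trace_insProd_mul_eq, hx, true_and]
    rw [if_neg (fun h => hz (huniq z h))]
  · intro h; exact absurd (Finset.mem_univ _) h

/-- ★ **The deformation sum**: `Σ_x Σ_ij tr(insProd_x)·(S'_ij : ℂ) = −2 Σ_{p ∈ 𝒫⁺(e)} Σ_{x ∈ C₁} (W(l ⊖ₓ p) − W(l ⊕ₓ p))`.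
[folklore] -/
theorem sum_deform_eq :
    ∑ x : Fin l.length, ∑ i : Fin N, ∑ j : Fin N,
        (insProd e.1 (soDir i j) l x U).trace * (actionDeriv' e.1 (soDir i j : Matrix (Fin N) (Fin N) ℂ) U : ℂ) =
      -(2 * ∑ p ∈ plaquettesAt e, ∑ x ∈ locs l e,
        ((holC U (negDeform l x p)).trace - (holC U (posDeform l x p)).trace)) := by
  simp only [ofReal_actionDeriv', mul_neg, Finset.sum_neg_distrib]
  rw [neg_inj]
  have h0 : ∀ (x : Fin l.length) (i j : Fin N), (insProd e.1 (soDir i j) l x U).trace *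
      ∑ p ∈ plaquettesTouching ({e.1} : Finset (ZdEdge d)), ∑ z : Fin (plaquetteWord p).length,
        (insProd e.1 (soDir i j) (plaquetteWord p) z U).trace =
      ∑ p ∈ plaquettesTouching ({e.1} : Finset (ZdEdge d)), (insProd e.1 (soDir i j) l x U).trace *
        ∑ z : Fin (plaquetteWord p).length, (insProd e.1 (soDir i j) (plaquetteWord p) z U).trace :=
    fun x i j => Finset.mul_sum _ _ _
  -- reorder: `Σ_x Σ_i Σ_j Σ_p Σ_z` → `Σ_p Σ_x Σ_z Σ_i Σ_j`
  have h1 : ∀ x : Fin l.length, ∑ i : Fin N, ∑ j : Fin N, ∑ p ∈ plaquettesTouching ({e.1} : Finset (ZdEdge d)),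
      (insProd e.1 (soDir i j) l x U).trace * ∑ z : Fin (plaquetteWord p).length,
        (insProd e.1 (soDir i j) (plaquetteWord p) z U).trace =
      ∑ p ∈ plaquettesTouching ({e.1} : Finset (ZdEdge d)), ∑ z : Fin (plaquetteWord p).length, ∑ i : Fin N, ∑ j : Fin N,
        (insProd e.1 (soDir i j) l x U).trace * (insProd e.1 (soDir i j) (plaquetteWord p) z U).trace := by
    intro x
    set A : Fin N → Fin N → ℂ := fun i j => (insProd e.1 (soDir i j) l x U).trace with hA
    set B : (p : ZdPlaquette d) → Fin (plaquetteWord p).length → Fin N → Fin N → ℂ :=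
      fun p z i j => (insProd e.1 (soDir i j) (plaquetteWord p) z U).trace with hB
    calc ∑ i : Fin N, ∑ j : Fin N, ∑ p ∈ plaquettesTouching ({e.1} : Finset (ZdEdge d)),
          A i j * ∑ z : Fin (plaquetteWord p).length, B p z i j
        = ∑ i : Fin N, ∑ j : Fin N, ∑ p ∈ plaquettesTouching ({e.1} : Finset (ZdEdge d)),
            ∑ z : Fin (plaquetteWord p).length, A i j * B p z i j := by
          simp only [Finset.mul_sum]
      _ = ∑ i : Fin N, ∑ p ∈ plaquettesTouching ({e.1} : Finset (ZdEdge d)), ∑ j : Fin N,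
            ∑ z : Fin (plaquetteWord p).length, A i j * B p z i j :=
          Finset.sum_congr rfl fun i _ => Finset.sum_comm
      _ = ∑ p ∈ plaquettesTouching ({e.1} : Finset (ZdEdge d)), ∑ i : Fin N, ∑ j : Fin N,
            ∑ z : Fin (plaquetteWord p).length, A i j * B p z i j := Finset.sum_comm
      _ = ∑ p ∈ plaquettesTouching ({e.1} : Finset (ZdEdge d)), ∑ i : Fin N, ∑ z : Fin (plaquetteWord p).length,
            ∑ j : Fin N, A i j * B p z i j :=
          Finset.sum_congr rfl fun p _ => Finset.sum_congr rfl fun i _ => Finset.sum_comm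
      _ = ∑ p ∈ plaquettesTouching ({e.1} : Finset (ZdEdge d)), ∑ z : Fin (plaquetteWord p).length, ∑ i : Fin N,
            ∑ j : Fin N, A i j * B p z i j :=
          Finset.sum_congr rfl fun p _ => Finset.sum_comm
  simp only [h0, h1]
  rw [Finset.mul_sum]
  conv_lhs => rw [Finset.sum_comm]
  refine Finset.sum_congr rfl fun p hp => ?_
  rw [Finset.mul_sum, ← Finset.sum_subset (Finset.subset_univ (locs l e)) (fun x _ hx => ?_)]
  · exact Finset.sum_congr rfl fun x hx => sum_deform_plaquette U l e hp ((mem_locs_iff l e x).1 hx)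
  · refine Finset.sum_eq_zero fun z _ => ?_
    have hx' : (l.get x).1 ≠ e.1 := fun h => hx ((mem_locs_iff l e x).2 h)
    simp [insProd_eq_zero_of_ne e.1 U l _ hx']

end Deform

end SOMasterLoop

end Summit.QuantumFields.GaugeBoot
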